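import Summits.HodgeConjecture.HodgeConjecture.Theses.HeckePrymWeil
import Summits.HodgeConjecture.HodgeConjecture.Theorems.HeckePrymWeilAimedDescendingProof
import Summits.HodgeConjecture.HodgeConjecture.Theorems.HeckePrymWeilHeckePrymAnchorsUpgrade
import Summits.HodgeConjecture.HodgeConjecture.Theorems.HeckePrymWeilHeckePrymAnchorsRationalAlongSection
import Summits.HodgeConjecture.HodgeConjecture.Theorems.HeckePrymWeilHeckePrymAnchorsGlobalClassOfLeray
import Summits.HodgeConjecture.HodgeConjecture.Theorems.HeckePrymWeilIsoInvariance
import Literature.AlgebraicGeometry.HodgeTheory.WeilFamilyReach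
import Literature.AlgebraicGeometry.HodgeTheory.WeilClassesRationalPlane
import Literature.AlgebraicGeometry.HodgeTheory.WeilClassesSixfoldsProofs
import Literature.AlgebraicGeometry.HodgeTheory.WeilClassesIsogenyDescent
import Literature.AlgebraicGeometry.HodgeTheory.InvariantClassesFromTotalSpaceHolds
import Literature.AlgebraicGeometry.HodgeTheory.ComplexConjugationHolds
import Literature.AlgebraicGeometry.Motives.AbelianVarietyCohomologyExteriorH1
import Literature.AlgebraicGeometry.Motives.VarietiesGeometricallyIntegralProofs
import HarnessLib

/-!
# `WeilTenfoldsSqrtMinus11` from ONE secant anchor and Deligne's reach (item stmt-HodgeConjecture-1262, route HeckePrymWeil)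

Line `generic-ppav-secant-descent` of crux `HeckePrymWeil.WeilTenfoldsSqrtMinus11`, re-based skeleton v2 (lead c3,
2026-08-17; source of the re-base: crux-strategist s1, `Cruxes/WeilTenfoldsSqrtMinus11/StrategyCensus1262.lean`,
`STRATEGY-CENSUS.md`). Two PROVED reductions, both CONDITIONAL only on their displayed hypotheses (no `def` is
introduced; theorems only):

* `weilTenfoldsSqrtMinus11_of_splitTwelvefolds` — the crux follows from the Hodge–Weil classes of the SPLIT
  `ℚ(√-11)` TWELVEFOLDS (split witnessed, as in `AimedDescending` / `HyperbolicEightfoldsSqrtMinus7`, by a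
  projective embedding whose `K`-symmetrised hyperplane class is of hyperbolic Weil type): the route's aimed
  component descent `AimedDescending` (stmt-14643) is PROVED (`Theorems.aimedDescending_proof`), instantiate it at
  `(p, n) = (11, 5)`. So the crux lives, unconditionally, in ONE component of the `ℚ(√-11)` twelvefold moduli —
  the component of the tensor anchors `X₆ × X̂₆`.
* `weilTenfoldsSqrtMinus11_of_weilFamilyReach_of_secantSpread` — the crux from the summit's shared named fact
  `HodgeTheory.weilFamilyReach_hyperbolic` (Deligne's polarized Weil family through a hyperbolic anchor, reaching
  every hyperbolic target up to `K`-isogeny) and the line's BET `stub_secantSpreadEmbedded` (ONE split anchor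
  twelvefold, polarised by a `K`-symmetrised hyperplane class, THROUGH WHICH flat rational Hodge sections `(hh, w)`
  of every smooth projective family are algebraic on every fibre — Markman's secant programme at `n = 6`), via the
  REACH BRIDGE `splitTwelvefolds_of_weilFamilyReach_of_secantSpread`: a non-zero rational Weil class `w` of the
  anchor (`exists_isRationalClass_ne_zero_mem_weilClassesOf`); the reach family through the anchor and the target
  with its global polarization `H` and continuous `(6,6)` Weil section `σ` through `w`; `σ` is the restriction of a
  GLOBAL class `W` (proved Leray engine `stub_globalClassOfSection_of_leray deligne1968_invariantClass_fromTotalSpace_holds`),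
  rational along (`stub_rationalAlongSection`); the bet applied to `(H|, W|)` makes `W|_{𝒳_s}` algebraic for all
  `s`; at the reached fibre this is a non-zero algebraic Weil class of `A'`, so the whole Weil plane of `A'` is
  algebraic (`weilClassesOf_le_algebraicClasses_iff_exists_ne_zero_of_dim_eq` with
  `abelianVarietyCohomologyExteriorH1_holds`); the proved isogeny descent
  `mem_algebraicClasses_of_isogeny_of_mem_weilClassesOf` returns to `A`, whose typed plane lies in the strong one
  (`stub_upgrade`).
[cite: Deligne1982HodgeCycles, proof of Thm. 4.8 (pp. 47–52) with Prop. 4.4] [cite: vanGeemen1994HodgeAV, 5.4 and proof of Thm. 6.12]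
[cite: Markman2025SurveySecant, §11.5 Step 2] [cite: Markman2025SecantWeil, Cor. 1.3.2 and Lemma 8.3.4]
-/

noncomputable section

-- single-problem summit (Problem = Summit): the mandated namespace repeats `HodgeConjecture`.
set_option linter.dupNamespace false

open CategoryTheory Complex AlgebraicGeometry MonoidalCategory CartesianMonoidalCategory
open Literature.AlgebraicGeometry Literature.AlgebraicGeometry.Motives
  Literature.AlgebraicGeometry.HodgeTheory Literature.AlgebraicTopology.SingularHomology
open Summit.HodgeConjecture.HodgeConjecture.Theses.HeckePrymWeil
open Summit.HodgeConjecture.HodgeConjecture.Theorems.HeckePrymWeilLine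
  (stub_upgrade stub_rationalAlongSection stub_globalClassOfSection_of_leray)

namespace Summit.HodgeConjecture.HodgeConjecture.Theorems.WeilTenfoldsSqrtMinus11.SecantSpread

/-- **The crux from split `√-11` twelvefolds** (route typing): `AimedDescending` is proved in the tree
(`Theorems.aimedDescending_proof`, stmt-14643); instantiate at `(p, n) = (11, 5)` — `11` prime, `11 % 4 = 3`,
`7 ≤ 11`, `1 ≤ 5`, and the rung predicates agree definitionally (`2 * (5 + 1) = 12`, `2 * 5 = 10`).
(Strategist s1's `weilTenfolds_of_hyperbolicTwelvefolds`, hypothesis inlined; registered sub-goal of the line.)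
[cite: Markman2025SurveySecant, §11.5 Step 2] [cite: Schoen1998HodgeWeilAddendum, §10] -/
theorem weilTenfoldsSqrtMinus11_of_splitTwelvefolds :
    (∀ (A : AbelianVariety ℂ) (φ : A ⟶ A), A.dim = 12 → φ ≫ φ = -((11 : ℤ) • 𝟙 A) →
          ∀ (e : ProjectiveEmbedding A.X) (a : complexBetti (projectiveSpace e.n ℂ) 2),
            IsRationalClass a → a ≠ 0 →
            IsHyperbolicWeilType A φ 6
              ((11 : ℂ) • complexBetti.map e.ι 2 a + complexBetti.map φ.hom.hom.hom 2 (complexBetti.map e.ι 2 a)) →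
            ∀ c : complexBetti A.X 12, IsRationalClass c → IsOfHodgeType 12 A.X 12 6 6 c →
              c ∈ Module.End.eigenspace (complexBetti.map (𝟙 A + φ).hom.hom.hom 12).hom
                    ((1 + Complex.I * (Real.sqrt (11 : ℝ) : ℂ)) ^ 12) ⊔
                  Module.End.eigenspace (complexBetti.map (𝟙 A + φ).hom.hom.hom 12).hom
                    ((1 - Complex.I * (Real.sqrt (11 : ℝ) : ℂ)) ^ 12) →
              c ∈ algebraicClasses A.X 6) →
            Summit.HodgeConjecture.HodgeConjecture.Theses.HeckePrymWeil.WeilTenfoldsSqrtMinus11 := by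
  intro h12
  have hAD : AimedDescending := Summit.HodgeConjecture.HodgeConjecture.Theorems.aimedDescending_proof
  unfold WeilTenfoldsSqrtMinus11
  unfold AimedDescending at hAD
  intro A φ hdim hφ c hc hH hW
  refine hAD 11 (by norm_num) (by norm_num) (by norm_num) 5 (by norm_num) ?_ A φ hdim hφ c hc hH hW
  intro m hm A' φ' hdim' hφ' e a ha ha0 hhyp c' hc' hH' hW'
  subst hm
  exact h12 A' φ' hdim' hφ' e a ha ha0 hhyp c' hc' hH' hW'

/-- **Reach bridge**: Deligne's reach (named fact `weilFamilyReach_hyperbolic`) and the line's bet (the statement of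
the registered stub `stub_secantSpreadEmbedded`, second hypothesis) give the Hodge–Weil classes of EVERY split
`ℚ(√-11)` twelvefold, in the route typing (registered sub-goal of the line). Mechanism in the module docstring.
[cite: Deligne1982HodgeCycles, proof of Thm. 4.8 with Prop. 4.4] [cite: vanGeemen1994HodgeAV, 5.4 and proof of Thm. 6.12] -/
theorem splitTwelvefolds_of_weilFamilyReach_of_secantSpread :
    weilFamilyReach_hyperbolic →
            (∃ (A₀ : AbelianVariety ℂ) (ψ₀ : A₀ ⟶ A₀) (e₀ : ProjectiveEmbedding A₀.X)
            (a₀ : complexBetti (projectiveSpace e₀.n ℂ) 2),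
            A₀.dim = 12 ∧ ψ₀ ≫ ψ₀ = -((11 : ℤ) • 𝟙 A₀) ∧ IsRationalClass a₀ ∧ a₀ ≠ 0 ∧
            IsHyperbolicWeilType A₀ ψ₀ 6
              ((11 : ℂ) • complexBetti.map e₀.ι 2 a₀ + complexBetti.map ψ₀.hom.hom.hom 2 (complexBetti.map e₀.ι 2 a₀)) ∧
            ∀ (𝒳 S : SchemeOver ℂ) (π : 𝒳 ⟶ S),
              IsSmoothProjectiveFamily π 12 → IsQuasiProjectiveOver S →
              _root_.AlgebraicGeometry.IsIntegral S.left → _root_.AlgebraicGeometry.Smooth S.hom →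
            ∀ (hh : ∀ s : ComplexPoints S, complexBetti (fiberOver π s) (2 * 1))
              (w : ∀ s : ComplexPoints S, complexBetti (fiberOver π s) (2 * 6)),
              Continuous (fun s => (⟨s, hh s⟩ : FiberClass π (2 * 1))) →
              Continuous (fun s => (⟨s, w s⟩ : FiberClass π (2 * 6))) →
              (∀ s, (⟨s, hh s⟩ : FiberClass π (2 * 1)) ∈ locusOfHodgeClasses π 12 1) →
              (∀ s, (⟨s, w s⟩ : FiberClass π (2 * 6)) ∈ locusOfHodgeClasses π 12 6) →
            ∀ (s₀ : ComplexPoints S) (ι₀ : fiberOver π s₀ ≅ A₀.X) (c₀ : complexBetti A₀.X 12),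
              c₀ ∈ Module.End.eigenspace (complexBetti.map (𝟙 A₀ + ψ₀).hom.hom.hom 12).hom
                      ((1 + Complex.I * (Real.sqrt (11 : ℝ) : ℂ)) ^ 12) ⊔
                    Module.End.eigenspace (complexBetti.map (𝟙 A₀ + ψ₀).hom.hom.hom 12).hom
                      ((1 - Complex.I * (Real.sqrt (11 : ℝ) : ℂ)) ^ 12) →
              hh s₀ = complexBetti.map ι₀.hom (2 * 1)
                ((11 : ℂ) • complexBetti.map e₀.ι 2 a₀ + complexBetti.map ψ₀.hom.hom.hom 2 (complexBetti.map e₀.ι 2 a₀)) →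
              w s₀ = complexBetti.map ι₀.hom (2 * 6) c₀ →
            ∀ s : ComplexPoints S, w s ∈ algebraicClasses (fiberOver π s) 6) →
            ∀ (A : AbelianVariety ℂ) (φ : A ⟶ A), A.dim = 12 → φ ≫ φ = -((11 : ℤ) • 𝟙 A) →
          ∀ (e : ProjectiveEmbedding A.X) (a : complexBetti (projectiveSpace e.n ℂ) 2),
            IsRationalClass a → a ≠ 0 →
            IsHyperbolicWeilType A φ 6
              ((11 : ℂ) • complexBetti.map e.ι 2 a + complexBetti.map φ.hom.hom.hom 2 (complexBetti.map e.ι 2 a)) →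
            ∀ c : complexBetti A.X 12, IsRationalClass c → IsOfHodgeType 12 A.X 12 6 6 c →
              c ∈ Module.End.eigenspace (complexBetti.map (𝟙 A + φ).hom.hom.hom 12).hom
                    ((1 + Complex.I * (Real.sqrt (11 : ℝ) : ℂ)) ^ 12) ⊔
                  Module.End.eigenspace (complexBetti.map (𝟙 A + φ).hom.hom.hom 12).hom
                    ((1 - Complex.I * (Real.sqrt (11 : ℝ) : ℂ)) ^ 12) →
              c ∈ algebraicClasses A.X 6 := by
  intro hR h₁ A φ hA hφ e a ha ha0 hhyp c hc hcH hcW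
  obtain ⟨A₀, ψ₀, e₀, a₀, hA₀, hψ₀, ha₀, ha₀0, hhyp₀, hspread⟩ := h₁
  -- casts (`p = 11` as a natural number, degrees `2 * 6`)
  have hA' : A.dim = 2 * 6 := hA
  have hA₀' : A₀.dim = 2 * 6 := hA₀
  have hφℕ : φ ≫ φ = -((11 : ℕ) • 𝟙 A) := by rw [hφ, ← natCast_zsmul]; rfl
  have hψ₀ℕ : ψ₀ ≫ ψ₀ = -((11 : ℕ) • 𝟙 A₀) := by rw [hψ₀, ← natCast_zsmul]; rfl
  have hφℤ : φ ≫ φ = -(((11 : ℕ) : ℤ) • 𝟙 A) := by exact_mod_cast hφ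
  -- the typed plane of `A` lies in the strong Weil plane (landed upgrade)
  have hcW' : c ∈ weilClassesOf A φ 6 11 := by
    refine stub_upgrade 11 (by norm_num) (by norm_num) (by norm_num) 6 A φ hA' hφℤ ?_
    exact_mod_cast hcW
  -- a non-zero rational Weil class on the anchor
  obtain ⟨w, hwW, hw0, hwrat⟩ :=
    exists_isRationalClass_ne_zero_mem_weilClassesOf (n := 6) (d := 11) (by norm_num) hA₀' (by norm_num) hψ₀ℕ
  -- Deligne's family through the anchor, reaching `A` (named fact)
  have hhyp₀' : IsHyperbolicWeilType A₀ ψ₀ 6 (((11 : ℕ) : ℂ) • complexBetti.map e₀.ι 2 a₀ +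
      complexBetti.map ψ₀.hom.hom.hom 2 (complexBetti.map e₀.ι 2 a₀)) := by exact_mod_cast hhyp₀
  have hhyp' : IsHyperbolicWeilType A φ 6 (((11 : ℕ) : ℂ) • complexBetti.map e.ι 2 a +
      complexBetti.map φ.hom.hom.hom 2 (complexBetti.map e.ι 2 a)) := by exact_mod_cast hhyp
  obtain ⟨𝒳, S, f, s₀, s₁, e', A', φ', e₁, σ, H, hfam, hemb, hirr, hsm, hSqp, hfib, hHfib, hH₀, hσc, hpt, hσH,
    hσ₀, hA'dim, hφ', ⟨u, v, m, hm, huv, hu, hv⟩, w₁, hσ₁, hw₁W, hw₁0⟩ :=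
    hR 6 11 (by norm_num) (by norm_num) A₀ ψ₀ e₀ a₀ hA₀' hψ₀ℕ ha₀ ha₀0 hhyp₀' w hwW hw0 A φ e a hA' hφℕ ha ha0 hhyp'
  -- the base is integral (smooth, hence reduced, and irreducible)
  haveI := hsm
  haveI := hirr
  haveI : IsReduced S.left := isReduced_of_smooth_over_field S.hom
  have hint : _root_.AlgebraicGeometry.IsIntegral S.left := isIntegral_of_irreducibleSpace_of_isReduced _
  -- the PROVED Leray engine: `σ` is the restriction of a global class `W`
  obtain ⟨W, hWσ⟩ := stub_globalClassOfSection_of_leray deligne1968_invariantClass_fromTotalSpace_holds f (2 * 6)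
    (2 * 6) hfam hemb hsm hSqp hirr σ hσc hpt
  have hcls : ∀ (s : ComplexPoints S) (y : complexBetti (fiberOver f s) (2 * 6)),
      σ s = ⟨s, y⟩ → complexBetti.map (fiberι f s) (2 * 6) W = y := by
    intro s y hy
    have h := (hWσ s).symm.trans hy
    simp only [globalSection, FiberClass.mk.injEq, heq_eq_eq, true_and] at h
    exact h
  have hW₀ : complexBetti.map (fiberι f s₀) (2 * 6) W = complexBetti.map e'.inv (2 * 6) w := hcls s₀ _ hσ₀
  have hW₁ : complexBetti.map (fiberι f s₁) (2 * 6) W = w₁ := hcls s₁ _ hσ₁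
  -- rationality along the section, Hodge type `(6,6)` everywhere
  have hrat₀ : IsRationalClass (σ s₀).cls := by
    rw [hσ₀]; exact hwrat.map _
  have hratσ : ∀ s, IsRationalClass (σ s).cls :=
    stub_rationalAlongSection f (2 * 6) (2 * 6) hfam hsm hSqp hirr σ hσc hpt s₀ hrat₀
  have hWrat : ∀ s, IsRationalClass (complexBetti.map (fiberι f s) (2 * 6) W) := by
    intro s
    have h := hratσ s
    rw [hWσ s] at h
    exact h
  have hWH : ∀ s, IsOfHodgeType (2 * 6) (fiberOver f s) (2 * 6) 6 6 (complexBetti.map (fiberι f s) (2 * 6) W) := by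
    intro s
    have h := hσH s
    rw [hWσ s] at h
    exact h
  -- the bet applied to the reach family, with `hh = H|` and `w = W|`
  have hh_cont : Continuous (fun s => (⟨s, complexBetti.map (fiberι f s) 2 H⟩ : FiberClass f (2 * 1))) :=
    continuous_globalSection f (2 * 1) H
  have hw_cont : Continuous (fun s => (⟨s, complexBetti.map (fiberι f s) (2 * 6) W⟩ : FiberClass f (2 * 6))) :=
    continuous_globalSection f (2 * 6) W
  have hh_loc : ∀ s, (⟨s, complexBetti.map (fiberι f s) 2 H⟩ : FiberClass f (2 * 1)) ∈
      locusOfHodgeClasses f 12 1 := fun s => (hHfib s)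
  have hw_loc : ∀ s, (⟨s, complexBetti.map (fiberι f s) (2 * 6) W⟩ : FiberClass f (2 * 6)) ∈
      locusOfHodgeClasses f 12 6 := fun s => ⟨hWrat s, hWH s⟩
  -- the anchor data read on `𝒳_{s₀}` through `ι₀ = e'⁻¹`
  have hh₀ : complexBetti.map (fiberι f s₀) 2 H = complexBetti.map e'.symm.hom (2 * 1)
      ((11 : ℂ) • complexBetti.map e₀.ι 2 a₀ + complexBetti.map ψ₀.hom.hom.hom 2 (complexBetti.map e₀.ι 2 a₀)) := by
    have h := congrArg (complexBetti.map e'.inv 2) hH₀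
    rw [e'.complexBetti_map_inv_map_hom] at h
    rw [h]
    push_cast
    rfl
  have hc₀W : w ∈ Module.End.eigenspace (complexBetti.map (𝟙 A₀ + ψ₀).hom.hom.hom 12).hom
        ((1 + Complex.I * (Real.sqrt (11 : ℝ) : ℂ)) ^ 12) ⊔
      Module.End.eigenspace (complexBetti.map (𝟙 A₀ + ψ₀).hom.hom.hom 12).hom
        ((1 - Complex.I * (Real.sqrt (11 : ℝ) : ℂ)) ^ 12) := by
    have h := weilClassesOf_le_eigenspace_sup_eigenspace ψ₀ 6 11 hwW
    exact_mod_cast h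
  have hw₀ : complexBetti.map (fiberι f s₀) (2 * 6) W = complexBetti.map e'.symm.hom (2 * 6) w := by
    rw [hW₀]; rfl
  have halgW : ∀ s, complexBetti.map (fiberι f s) (2 * 6) W ∈ algebraicClasses (fiberOver f s) 6 :=
    hspread 𝒳 S f hfam hSqp hint hsm (fun s => complexBetti.map (fiberι f s) 2 H)
      (fun s => complexBetti.map (fiberι f s) (2 * 6) W) hh_cont hw_cont hh_loc hw_loc s₀ e'.symm w hc₀W hh₀ hw₀
  -- at `s₁`: a non-zero ALGEBRAIC Weil class on `A' ≅ 𝒳_{s₁}`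
  have hw₁alg : complexBetti.map e₁.hom (2 * 6) w₁ ∈ algebraicClasses A'.X 6 := by
    have h := halgW s₁
    rw [hW₁] at h
    exact Summit.HodgeConjecture.HodgeConjecture.Theorems.isoInvariance_proof e₁ 6 w₁ h
  -- one class suffices on `A'`
  have hle : weilClassesOf A' φ' 6 11 ≤ algebraicClasses A'.X 6 :=
    (weilClassesOf_le_algebraicClasses_iff_exists_ne_zero_of_dim_eq abelianVarietyCohomologyExteriorH1_holds
      hA'dim (by norm_num) (by norm_num) hφ').mpr ⟨_, hw₁W, hw₁alg, hw₁0⟩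
  -- isogeny descent `A → A'` (proved in the tree)
  have hAsp : IsSmoothProjective (2 * 6) A.X := by
    have h := AbelianVariety.isSmoothProjective_holds (A := A)
    rw [AbelianVariety.isSmoothProjective, hA'] at h
    exact h
  have hA'sp : IsSmoothProjective (2 * 6) A'.X := by
    have h := AbelianVariety.isSmoothProjective_holds (A := A')
    rw [AbelianVariety.isSmoothProjective, hA'dim] at h
    exact h
  obtain ⟨MA'⟩ := (nonempty_hodgeModel_holds (n := 2 * 6) (X := A'.X)).nonempty hA'sp
  haveI : Flat u.hom.hom.hom.left := hu
  have hcH' : IsOfHodgeType (2 * 6) A.X (2 * 6) 6 6 c := hcH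
  exact mem_algebraicClasses_of_isogeny_of_mem_weilClassesOf hAsp hA'sp MA' u v hv hm huv
    (fun c' _ _ hc'W => hle hc'W) hc hcH' hcW'

/-- **`WeilTenfoldsSqrtMinus11` from Deligne's reach and ONE secant anchor** (the line's composition, CONDITIONAL on
the named fact and on the bet, both displayed; registered sub-goal of the line): reach bridge, then the proved aimed
descent. [cite: Deligne1982HodgeCycles, proof of Thm. 4.8 with Prop. 4.4] [cite: Markman2025SurveySecant, §11.5 Step 2] -/
theorem weilTenfoldsSqrtMinus11_of_weilFamilyReach_of_secantSpread :
    weilFamilyReach_hyperbolic →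
            (∃ (A₀ : AbelianVariety ℂ) (ψ₀ : A₀ ⟶ A₀) (e₀ : ProjectiveEmbedding A₀.X)
            (a₀ : complexBetti (projectiveSpace e₀.n ℂ) 2),
            A₀.dim = 12 ∧ ψ₀ ≫ ψ₀ = -((11 : ℤ) • 𝟙 A₀) ∧ IsRationalClass a₀ ∧ a₀ ≠ 0 ∧
            IsHyperbolicWeilType A₀ ψ₀ 6
              ((11 : ℂ) • complexBetti.map e₀.ι 2 a₀ + complexBetti.map ψ₀.hom.hom.hom 2 (complexBetti.map e₀.ι 2 a₀)) ∧
            ∀ (𝒳 S : SchemeOver ℂ) (π : 𝒳 ⟶ S),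
              IsSmoothProjectiveFamily π 12 → IsQuasiProjectiveOver S →
              _root_.AlgebraicGeometry.IsIntegral S.left → _root_.AlgebraicGeometry.Smooth S.hom →
            ∀ (hh : ∀ s : ComplexPoints S, complexBetti (fiberOver π s) (2 * 1))
              (w : ∀ s : ComplexPoints S, complexBetti (fiberOver π s) (2 * 6)),
              Continuous (fun s => (⟨s, hh s⟩ : FiberClass π (2 * 1))) →
              Continuous (fun s => (⟨s, w s⟩ : FiberClass π (2 * 6))) →
              (∀ s, (⟨s, hh s⟩ : FiberClass π (2 * 1)) ∈ locusOfHodgeClasses π 12 1) →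
              (∀ s, (⟨s, w s⟩ : FiberClass π (2 * 6)) ∈ locusOfHodgeClasses π 12 6) →
            ∀ (s₀ : ComplexPoints S) (ι₀ : fiberOver π s₀ ≅ A₀.X) (c₀ : complexBetti A₀.X 12),
              c₀ ∈ Module.End.eigenspace (complexBetti.map (𝟙 A₀ + ψ₀).hom.hom.hom 12).hom
                      ((1 + Complex.I * (Real.sqrt (11 : ℝ) : ℂ)) ^ 12) ⊔
                    Module.End.eigenspace (complexBetti.map (𝟙 A₀ + ψ₀).hom.hom.hom 12).hom
                      ((1 - Complex.I * (Real.sqrt (11 : ℝ) : ℂ)) ^ 12) →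
              hh s₀ = complexBetti.map ι₀.hom (2 * 1)
                ((11 : ℂ) • complexBetti.map e₀.ι 2 a₀ + complexBetti.map ψ₀.hom.hom.hom 2 (complexBetti.map e₀.ι 2 a₀)) →
              w s₀ = complexBetti.map ι₀.hom (2 * 6) c₀ →
            ∀ s : ComplexPoints S, w s ∈ algebraicClasses (fiberOver π s) 6) →
            Summit.HodgeConjecture.HodgeConjecture.Theses.HeckePrymWeil.WeilTenfoldsSqrtMinus11 :=
  fun hR h₁ => weilTenfoldsSqrtMinus11_of_splitTwelvefolds (splitTwelvefolds_of_weilFamilyReach_of_secantSpread hR h₁)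

end Summit.HodgeConjecture.HodgeConjecture.Theorems.WeilTenfoldsSqrtMinus11.SecantSpread

end
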